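import Summits.BirchSwinnertonDyer.BirchSwinnertonDyer.Theorems.ResidualThetaTransportAtTwoThetaLayerLambdaCongruenceAtTwoCuspSpanFourInvariancePrimePow
import Mathlib.NumberTheory.LegendreSymbol.QuadraticReciprocity
import Mathlib.NumberTheory.Padics.PadicVal.Basic
import HarnessLib

/-!
# Route `ResidualThetaTransportAtTwo`, cruxes Kan⁺ (stmt-BirchSwinnertonDyer-20688) / 21437, node `CuspSpanEvenAtTwo N`:
# the AUXILIARY PRIME of the three-fold `B₁`-product device at an arbitrary level `N`

Cell `bsd-wall`, width seat `bsd-wall-rtt-p3-w4` g2 (2026-08-28), lane «3-fold B₁-products at prime-power and composite level»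
(device of `bsd-wall-rtt-p3-w2` g4 at prime level). THEOREMS ONLY, pure arithmetic; `--supports stmt-BirchSwinnertonDyer-20688`;
BSD is not proved by this.

* §1 `exists_aux_prime` — for an odd `N ≥ 1`, an odd prime `q` prime to `N`, and `u` prime to `N` with `u ≢ 1 (mod ℓ)` for every prime
  `ℓ` dividing both `N` and `O := ord_N(q)`: there is a prime `n` (beyond any bound) with `n ≡ u (mod N)`, `q^e ∣ n + 1`
  (`e = v_q(4^{q−1} − 1)`), `n ≡ 3 (mod 4)` and `gcd((n−1)/2, O) = 1` (Dirichlet + CRT: `n ≡ −1` modulo `4 q^e R`, `R` the product of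
  the odd primes of `O` not dividing `qN`; a common prime of `(n−1)/2` and `O` would be `2` — but `(n−1)/2` is odd —, `q` or a prime of
  `R` — but `n ≡ −1` there —, or a prime of `N` — excluded by hypothesis).
* §2 `pow_half_pred_eq_one_of_prime` — for primes `n ≡ 3 (mod 4)` and odd `q ∣ n + 1`: `q^{(n−1)/2} ≡ 1 (mod n)` (quadratic
  reciprocity: `(q/n) = (−1)^{(q−1)/2} (n/q) = (−1)^{(q−1)/2} (−1/q) = 1`, then Euler's criterion), hence `ord_n(q) ∣ (n−1)/2`.
* §3 `exists_exponent` — an exponent `t ≥ 1` with `ord_n(q) ∣ t` and `t ≡ 1 (mod O)`.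

References: [IrelandRosen1990] Ch. 5 (quadratic reciprocity); Dirichlet / Mathlib `Nat.forall_exists_prime_gt_and_modEq`;
[Pollack2003] Conj. 6.3 (the node this serves).
-/

set_option autoImplicit false
set_option linter.dupNamespace false

namespace Summit.BirchSwinnertonDyer.BirchSwinnertonDyer.Theorems.SignedMuAtTwo.TriangleN

/-! ## §1. The auxiliary prime -/

/-- **The auxiliary prime.** See the module docstring. [cite: IrelandRosen1990, Ch. 5] -/
theorem exists_aux_prime (N q u B : ℕ) (hN : Odd N) (hq : q.Prime) (hq2 : q ≠ 2) (hqN : Nat.Coprime q N)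
    (hu : Nat.Coprime u N)
    (hu1 : ∀ ℓ : ℕ, ℓ.Prime → ℓ ∣ N → ℓ ∣ orderOf (q : ZMod N) → ¬ u ≡ 1 [MOD ℓ]) :
    ∃ n : ℕ, B < n ∧ n.Prime ∧ n ≡ u [MOD N] ∧ q ^ padicValNat q (4 ^ (q - 1) - 1) ∣ n + 1 ∧ n % 4 = 3 ∧
      Nat.Coprime ((n - 1) / 2) (orderOf (q : ZMod N)) := by
  classical
  have hq3 : 3 ≤ q := by
    rcases hq.eq_two_or_odd with h | h
    · exact absurd h hq2
    · have := hq.two_le; omega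
  have hN1 : 1 ≤ N := hN.pos
  set e : ℕ := padicValNat q (4 ^ (q - 1) - 1) with he_def
  have he1 : 1 ≤ e := by
    -- Fermat: `q ∣ 4^{q−1} − 1`
    haveI := Fact.mk hq
    have h4 : (4 : ZMod q) ≠ 0 := by
      intro h0
      have h0' : ((4 : ℕ) : ZMod q) = 0 := by exact_mod_cast h0
      have h4 : q ∣ 2 ^ 2 := by norm_num; exact (ZMod.natCast_eq_zero_iff 4 q).mp h0'
      exact hq2 ((Nat.prime_dvd_prime_iff_eq hq Nat.prime_two).mp (hq.dvd_of_dvd_pow h4))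
    have hF : (4 : ZMod q) ^ (q - 1) = 1 := ZMod.pow_card_sub_one_eq_one h4
    have h1 : 1 ≤ 4 ^ (q - 1) := Nat.one_le_pow _ _ (by norm_num)
    have hdvd : q ∣ 4 ^ (q - 1) - 1 := by
      refine (Nat.modEq_iff_dvd' h1).mp ?_
      rw [Nat.ModEq.comm, ← ZMod.natCast_eq_natCast_iff]
      push_cast
      exact hF
    have hne : 4 ^ (q - 1) - 1 ≠ 0 := by
      have : 4 ^ 1 ≤ 4 ^ (q - 1) := Nat.pow_le_pow_right (by norm_num) (by omega)
      omega
    exact one_le_padicValNat_of_dvd hne hdvd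
  set O : ℕ := orderOf (q : ZMod N) with hO_def
  -- the odd primes of `O` away from `q N`
  set R : ℕ := ∏ ℓ ∈ O.primeFactors.filter (fun ℓ => ¬ ℓ ∣ 2 * q * N), ℓ with hR_def
  have hRpos : 0 < R := Finset.prod_pos fun ℓ hℓ ↦ (Nat.prime_of_mem_primeFactors (Finset.mem_filter.mp hℓ).1).pos
  have hRdvd : ∀ ℓ ∈ O.primeFactors.filter (fun ℓ => ¬ ℓ ∣ 2 * q * N), ℓ ∣ R := fun ℓ hℓ ↦ Finset.dvd_prod_of_mem _ hℓ
  have hRcop : Nat.Coprime R N := by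
    refine Nat.Coprime.prod_left fun ℓ hℓ ↦ ?_
    obtain ⟨hℓO, hℓn⟩ := Finset.mem_filter.mp hℓ
    have hℓp := Nat.prime_of_mem_primeFactors hℓO
    exact (Nat.Prime.coprime_iff_not_dvd hℓp).mpr fun h ↦ hℓn (h.mul_left _)
  set M : ℕ := 4 * q ^ e * R with hM_def
  have hM1 : 1 ≤ M := Nat.one_le_iff_ne_zero.mpr (Nat.mul_ne_zero (Nat.mul_ne_zero (by norm_num) (pow_ne_zero _ hq.ne_zero)) hRpos.ne')
  have hMN : Nat.Coprime M N := by
    refine Nat.Coprime.mul_left (Nat.Coprime.mul_left ?_ (Nat.Coprime.pow_left _ hqN)) hRcop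
    -- `4 ⊥ N` since `N` is odd
    rw [show (4 : ℕ) = 2 ^ 2 by norm_num]
    exact Nat.Coprime.pow_left _ (Nat.coprime_two_left.mpr hN)
  obtain ⟨n, hBn, hnp, hnM, hnN⟩ := exists_prime_modEq_pair M N u B hM1 hN1 hMN hu
  -- consequences of `n ≡ −1 (mod M)`
  have hMdvd : M ∣ n + 1 := by
    have e1 : n + 1 ≡ M - 1 + 1 [MOD M] := hnM.add_right 1
    rw [Nat.sub_add_cancel hM1] at e1
    exact Nat.modEq_zero_iff_dvd.mp (e1.trans (Nat.modEq_zero_iff_dvd.mpr dvd_rfl))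
  have h4dvd : 4 ∣ n + 1 := (Dvd.intro (q ^ e * R) (by rw [hM_def]; ring) : 4 ∣ M).trans hMdvd
  have hqe : q ^ e ∣ n + 1 := (Dvd.intro (4 * R) (by rw [hM_def]; ring) : q ^ e ∣ M).trans hMdvd
  have hRn : R ∣ n + 1 := (Dvd.intro (4 * q ^ e) (by rw [hM_def]; ring) : R ∣ M).trans hMdvd
  have hn4 : n % 4 = 3 := by omega
  refine ⟨n, hBn, hnp, hnN, hqe, hn4, ?_⟩
  -- coprimality of `(n−1)/2` with `O`
  rw [Nat.coprime_iff_gcd_eq_one]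
  by_contra hg
  obtain ⟨ℓ, hℓp, hℓ⟩ := Nat.exists_prime_and_dvd hg
  have hℓh : ℓ ∣ (n - 1) / 2 := hℓ.trans (Nat.gcd_dvd_left _ _)
  have hℓO : ℓ ∣ O := hℓ.trans (Nat.gcd_dvd_right _ _)
  have hOpos : 0 < O := by
    haveI : NeZero N := ⟨by omega⟩
    have hqu : IsUnit (q : ZMod N) := (ZMod.isUnit_iff_coprime q N).mpr hqN
    have h := (isOfFinOrder_of_finite hqu.unit).orderOf_pos
    rwa [← orderOf_units, IsUnit.unit_spec] at h
  have hh : (n - 1) / 2 * 2 = n - 1 := Nat.div_mul_cancel (by omega)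
  have hℓn1 : ℓ ∣ n - 1 := hℓh.trans (Dvd.intro 2 hh)
  rcases Nat.Prime.eq_two_or_odd hℓp with h2 | hodd
  · -- `ℓ = 2` but `(n−1)/2` is odd
    subst h2
    omega
  · have hℓ2 : ¬ ℓ ∣ 2 := fun h ↦ by
      have := (Nat.prime_dvd_prime_iff_eq hℓp Nat.prime_two).mp h
      omega
    -- `ℓ ∣ n − 1`; if also `ℓ ∣ n + 1` then `ℓ ∣ 2`
    have key : ¬ ℓ ∣ n + 1 := by
      intro h
      apply hℓ2
      have := Nat.dvd_sub h hℓn1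
      rwa [show n + 1 - (n - 1) = 2 by omega] at this
    by_cases hℓq : ℓ = q
    · subst hℓq
      exact key ((dvd_pow_self ℓ (by omega)).trans hqe)
    by_cases hℓN : ℓ ∣ N
    · -- `n ≡ u (mod ℓ)` and `ℓ ∣ n − 1` contradict `u ≢ 1 (mod ℓ)`
      apply hu1 ℓ hℓp hℓN hℓO
      have h1 : n ≡ u [MOD ℓ] := hnN.of_dvd hℓN
      have h2 : n ≡ 1 [MOD ℓ] := (Nat.modEq_iff_dvd' (by omega)).mpr hℓn1 |>.symm
      exact h1.symm.trans h2
    · -- `ℓ ∣ R`, so `ℓ ∣ n + 1`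
      have hmem : ℓ ∈ O.primeFactors.filter (fun ℓ => ¬ ℓ ∣ 2 * q * N) := by
        refine Finset.mem_filter.mpr ⟨Nat.mem_primeFactors.mpr ⟨hℓp, hℓO, hOpos.ne'⟩, ?_⟩
        intro h
        rcases (Nat.Prime.dvd_mul hℓp).mp h with h' | h'
        · rcases (Nat.Prime.dvd_mul hℓp).mp h' with h'' | h''
          · exact hℓ2 h''
          · exact hℓq ((Nat.prime_dvd_prime_iff_eq hℓp hq).mp h'')
        · exact hℓN h'
      exact key ((hRdvd ℓ hmem).trans hRn)

/-! ## §2. `q^{(n−1)/2} ≡ 1 (mod n)` by quadratic reciprocity -/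

/-- **`(q/n) = +1` for primes `n ≡ 3 (mod 4)` and odd primes `q ∣ n + 1`; hence `q^{(n−1)/2} = 1` in `ZMod n`** and
`ord_n(q) ∣ (n−1)/2`. [cite: IrelandRosen1990, Ch. 5] -/
theorem pow_half_pred_eq_one_of_prime {n q : ℕ} (hn : n.Prime) (hq : q.Prime) (hq2 : q ≠ 2) (hn4 : n % 4 = 3)
    (hqn : q ∣ n + 1) : (q : ZMod n) ^ ((n - 1) / 2) = 1 ∧ orderOf (q : ZMod n) ∣ (n - 1) / 2 := by
  haveI := Fact.mk hn
  haveI := Fact.mk hq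
  have hn2 : n ≠ 2 := by rintro rfl; norm_num at hn4
  have hnq : n ≠ q := by
    rintro rfl
    have : n ∣ 1 := by simpa using Nat.dvd_sub hqn (dvd_refl n)
    exact hn.one_lt.ne' (Nat.dvd_one.mp this)
  have hqodd : q % 2 = 1 := Nat.odd_iff.mp ((hq.eq_two_or_odd').resolve_left hq2)
  -- `(n/q) = (−1/q)`
  have hcast : ((n : ℤ) : ZMod q) = ((-1 : ℤ) : ZMod q) := by
    have : ((n + 1 : ℕ) : ZMod q) = 0 := (ZMod.natCast_eq_zero_iff _ _).mpr hqn
    push_cast at this ⊢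
    linear_combination this
  have h1 : legendreSym q n = legendreSym q (-1) := by
    simp only [legendreSym]; rw [hcast]
  have h2 : legendreSym q (-1) = (-1) ^ (q / 2) := by
    rw [legendreSym.at_neg_one hq2, ZMod.χ₄_eq_neg_one_pow hqodd]
  -- reciprocity
  have h3 : legendreSym n q = (-1) ^ (q / 2 * (n / 2)) * legendreSym q n :=
    legendreSym.quadratic_reciprocity' hq2 hn2
  have hhalf : n / 2 = (n - 1) / 2 := by omega
  have hodd : Odd (n / 2) := ⟨(n / 2) / 2, by omega⟩
  have h4 : legendreSym n q = 1 := by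
    rw [h3, h1, h2, ← pow_add, ← mul_add_one]
    obtain ⟨k, hk⟩ := hodd
    rw [hk, show 2 * k + 1 + 1 = 2 * (k + 1) by ring, ← mul_assoc, mul_comm (q / 2) 2, mul_assoc, pow_mul]
    norm_num
  have h5 := legendreSym.eq_pow n q
  rw [h4, hhalf] at h5
  push_cast at h5
  refine ⟨h5.symm, orderOf_dvd_of_pow_eq_one h5.symm⟩

/-! ## §3. The exponent -/

/-- An exponent `t ≥ 1` with `m ∣ t` and `t ≡ 1 (mod O)`, for coprime `m ≥ 1`, `O ≥ 1`. [folklore] -/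
theorem exists_exponent (m O : ℕ) (hm : 1 ≤ m) (hO : 1 ≤ O) (h : Nat.Coprime m O) :
    ∃ t : ℕ, 1 ≤ t ∧ m ∣ t ∧ t ≡ 1 [MOD O] := by
  obtain ⟨t₀, ht₀m, ht₀O⟩ := Nat.chineseRemainder h 0 1
  refine ⟨t₀ + m * O, by nlinarith, ?_, ?_⟩
  · exact dvd_add (Nat.modEq_zero_iff_dvd.mp ht₀m) (dvd_mul_right _ _)
  · have : m * O ≡ 0 [MOD O] := Nat.modEq_zero_iff_dvd.mpr (dvd_mul_left _ _)
    simpa using ht₀O.add this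

end Summit.BirchSwinnertonDyer.BirchSwinnertonDyer.Theorems.SignedMuAtTwo.TriangleN
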